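import Summits.Ventures.Crystal3D.Theorems.StickyWulffConstantCoaxialWallLawOnSiteTools
import HarnessLib

/-!
# The on-site DOMINATION: at a Barlow window the (A)-end pairs of ANY plate system pair are signature pairs of ONE row
# (crux `CoaxialWallLaw`, stmt-Ventures-19481, line `WallLedgerF`)

HONEST FRAMING. Venture `Summits/Ventures/Crystal3D` (cell `crystal3d-full`), helper `--supports` the crux
`CoaxialWallLaw` (stmt-Ventures-19481, `route-Ventures-StickyWulffConstant`), REGISTERED line `WallLedgerF` (planner
cf-p1).  Rung credit; F-C1 not moved; census-free.  cf-p1 ORDER 2026-08-28T21:28:15Z item (2): the heart of the bridge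
«on-site fact (`EndRowOnSiteA`, `…EndRowOnSiteDefsA`) ⇒ typed rows at on-site windows».  Inputs: the frame lemma
(`…BarlowWindowFrames`), the class collapse and twin collapse (`…ClassCollapse`), slot-dozen invariance
(`…SigInvariance`), the tools file.

SETTING: a configuration `Y` whose closed radius-`3` window about the origin lies on the sites of a Barlow stacking
`barlowStacking 1 √(2/3) s` (any Hägg `s`); end pairs `(b, q)` with `|b| ≤ 1`.
* **`dominate_of_collapse`** — two plate systems with basal roots sharing ONE collapse datum `(F, σ, ε)`: every (A)-end
  pair is a signature pair of `transSigs ε n` for ONE model normal `n`;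
* **`dominate_twin_of_roots`** — a basal-axis standard base frame `L′` and its half-turn companion whose standard
  classes are all ROOT classes: every (A)-end pair is a signature pair of `twinSigs ε h` for ONE basal slot `h`;
* **`dominate_trans`** — for `⟨L′, R₁⟩, ⟨L′, R₂⟩` (basal roots, ANY `L′`) some `transSigs ε n` dominates;
* **`dominate_twin`** — for `⟨L′, R⟩, ⟨H ≫ L′, R⟩` (`R` basal in an open half-plane, ANY `L′`) some `transSigs ε n` or
  some `twinSigs ε h` dominates.
WHAT THIS IS NOT: not the summand comparison / assembly (next file), not the tail; F-C1 not moved.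
-/

noncomputable section

namespace Summit.Ventures.Crystal3D.Theorems

open Summit.Ventures.Crystal3D Finset
open Literature.MathematicalPhysics.StatisticalMechanics (barlowPos barlowStacking fccStacking constHagg IsHaggSeq
  basalMirror basalMirror_apply_coord basalMirror_basalMirror)
open scoped InnerProductSpace

section Dominate

variable {v : WordVersion} {Y : Finset (EuclideanSpace ℝ (Fin 3))} {s : ℤ → ℤ} (hs : IsHaggSeq s)
  (hY : ∀ x ∈ Y, dist (0 : EuclideanSpace ℝ (Fin 3)) x ≤ 3 → x ∈ barlowStacking 1 (Real.sqrt (2 / 3)) s)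
include hs hY

/-- At an (A)-end pair `(b, q)` with `|b| ≤ 1` of systems with slot roots, the mover `q` is a window site whose unit
sphere lies on the stacking, so the frame lemma applies to its class frame. -/
theorem std_of_isEndPairA {S₁ S₂ : PlateSystem} (hR₁ : S₁.RT ⊆ fccSlots) (hR₂ : S₂.RT ⊆ fccSlots)
    {b q : EuclideanSpace ℝ (Fin 3)} (hb : dist (0 : EuclideanSpace ℝ (Fin 3)) b ≤ 1) (h : IsEndPairA Y v S₁ S₂ b q)
    {G : EuclideanSpace ℝ (Fin 3) ≃ₗᵢ[ℝ] EuclideanSpace ℝ (Fin 3)} {d : EuclideanSpace ℝ (Fin 3)}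
    (hmove : IsEndMove Y v G d q b) :
    (G : EuclideanSpace ℝ (Fin 3) → EuclideanSpace ℝ (Fin 3)) '' ↑fccSlots = ↑fccSlots ∨
      (G : EuclideanSpace ℝ (Fin 3) → EuclideanSpace ℝ (Fin 3)) '' ↑fccSlots =
        (basalMirror : EuclideanSpace ℝ (Fin 3) → EuclideanSpace ℝ (Fin 3)) '' ↑fccSlots := by
  have hbq : dist b q = 1 := dist_eq_one_of_isEndPair hR₁ hR₂ (isEndPair_of_isEndPairA h)
  have hq : q ∈ Y := h.1
  have hq2 : dist (0 : EuclideanSpace ℝ (Fin 3)) q ≤ 2 := by linarith [dist_triangle (0 : EuclideanSpace ℝ (Fin 3)) b q]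
  refine frame_of_isEndMove_barlow hs (hY q hq (by linarith)) (fun x hx hqx => hY x hx ?_) hmove
  linarith [dist_triangle (0 : EuclideanSpace ℝ (Fin 3)) q x]

/-- **DOMINATION FROM A SHARED COLLAPSE DATUM.**  See the module docstring. -/
theorem dominate_of_collapse (S₁ S₂ : PlateSystem) (hR₁ : S₁.RT ⊆ basalHexagon) (hR₂ : S₂.RT ⊆ basalHexagon)
    (ε : Bool) (F : EuclideanSpace ℝ (Fin 3) ≃ₗᵢ[ℝ] EuclideanSpace ℝ (Fin 3)) (σ : ℝ) (hσ : σ = 1 ∨ σ = -1)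
    (hF : (F : EuclideanSpace ℝ (Fin 3) → EuclideanSpace ℝ (Fin 3)) '' ↑fccSlots =
      (sigFrame ε : EuclideanSpace ℝ (Fin 3) → EuclideanSpace ℝ (Fin 3)) '' ↑fccSlots)
    (hcol : ∀ S : PlateSystem, (S = S₁ ∨ S = S₂) → ∀ r ∈ S.RT, ∀ κ : List (EuclideanSpace ℝ (Fin 3)), WFChain r κ →
      ((S.Fw κ : EuclideanSpace ℝ (Fin 3) → EuclideanSpace ℝ (Fin 3)) '' ↑fccSlots = ↑fccSlots ∨
        (S.Fw κ : EuclideanSpace ℝ (Fin 3) → EuclideanSpace ℝ (Fin 3)) '' ↑fccSlots =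
          (basalMirror : EuclideanSpace ℝ (Fin 3) → EuclideanSpace ℝ (Fin 3)) '' ↑fccSlots) →
      ((S.Fw κ : EuclideanSpace ℝ (Fin 3) → EuclideanSpace ℝ (Fin 3)) '' ↑fccSlots =
          (F : EuclideanSpace ℝ (Fin 3) → EuclideanSpace ℝ (Fin 3)) '' ↑fccSlots ∧
        S.Fw κ (((-1 : ℝ) ^ κ.length) • r) = σ • F r) ∨
      ((S.Fw κ : EuclideanSpace ℝ (Fin 3) → EuclideanSpace ℝ (Fin 3)) '' ↑fccSlots =
          (basalMirror : EuclideanSpace ℝ (Fin 3) → EuclideanSpace ℝ (Fin 3)) ''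
            ((F : EuclideanSpace ℝ (Fin 3) → EuclideanSpace ℝ (Fin 3)) '' ↑fccSlots) ∧
        S.Fw κ (((-1 : ℝ) ^ κ.length) • r) = -basalMirror (σ • F r) ∧ (F r) 2 ≠ 0)) :
    ∃ n ∈ modelNormals, ∀ b q : EuclideanSpace ℝ (Fin 3), dist (0 : EuclideanSpace ℝ (Fin 3)) b ≤ 1 →
      IsEndPairA Y v S₁ S₂ b q → IsEndPairSig Y v (transSigs ε n) b q := by
  classical
  set e₃ : EuclideanSpace ℝ (Fin 3) := EuclideanSpace.single (2 : Fin 3) (1 : ℝ) with he₃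
  -- involution facts of the standard frame
  have hinv : ∀ x, sigFrame ε (sigFrame ε x) = x := by
    intro x; conv_lhs => rw [← sigFrame_symm_apply ε (sigFrame ε x)]; exact (sigFrame ε).symm_apply_apply x
  have hadj : ∀ x y, ⟪sigFrame ε x, y⟫_ℝ = ⟪x, sigFrame ε y⟫_ℝ := by
    intro x y; rw [← LinearIsometryEquiv.inner_map_map (sigFrame ε) x (sigFrame ε y), hinv]
  -- every vector of `img F` is a standard-frame slot image
  have hpull : ∀ y ∈ (F : EuclideanSpace ℝ (Fin 3) → EuclideanSpace ℝ (Fin 3)) '' ↑fccSlots, sigFrame ε y ∈ fccSlots := by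
    intro y hy
    rw [hF] at hy
    obtain ⟨w₀, hw₀, rfl⟩ := hy
    rw [hinv]; exact mem_coe.1 hw₀
  -- the row plane normal
  set n : EuclideanSpace ℝ (Fin 3) := sigFrame ε (F e₃) with hn
  have hn1 : ‖n‖ = 1 := by rw [hn, LinearIsometryEquiv.norm_map, LinearIsometryEquiv.norm_map, he₃, PiLp.norm_single, norm_one]
  have hnmenu : ∀ w ∈ fccSlots, ⟪w, n⟫_ℝ = 0 ∨ ⟪w, n⟫_ℝ = Real.sqrt (2 / 3) ∨ ⟪w, n⟫_ℝ = -Real.sqrt (2 / 3) := by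
    intro w hw
    have hmem : sigFrame ε w ∈ (F : EuclideanSpace ℝ (Fin 3) → EuclideanSpace ℝ (Fin 3)) '' ↑fccSlots := by
      rw [hF]; exact ⟨w, mem_coe.2 hw, rfl⟩
    obtain ⟨w', hw', heq⟩ := hmem
    rw [hn, ← hadj, ← heq, LinearIsometryEquiv.inner_map_map, inner_single_two_one]
    exact slot_apply_two_cases (mem_coe.1 hw')
  refine ⟨n, mem_modelNormals_of_menu hn1 hnmenu, ?_⟩
  intro b q hb hpair
  have hR₁s : S₁.RT ⊆ fccSlots := fun r hr => (mem_filter.1 (hR₁ hr)).1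
  have hR₂s : S₂.RT ⊆ fccSlots := fun r hr => (mem_filter.1 (hR₂ hr)).1
  obtain ⟨hq, hbY, hpay, G, d, hadm, hqd, hmove⟩ := hpair
  have hstd := std_of_isEndPairA hs hY hR₁s hR₂s hb ⟨hq, hbY, hpay, G, d, hadm, hqd, hmove⟩ hmove
  -- the class datum, from whichever system
  obtain ⟨S, hS, hRS, hadmS⟩ : ∃ S : PlateSystem, (S = S₁ ∨ S = S₂) ∧ S.RT ⊆ basalHexagon ∧ S.Adm G d := by
    rcases hadm with h | h
    · exact ⟨S₁, Or.inl rfl, hR₁, h⟩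
    · exact ⟨S₂, Or.inr rfl, hR₂, h⟩
  obtain ⟨r, hr, κ, hκ, hG, hd⟩ := hadmS
  obtain ⟨hrS, hr2⟩ := mem_filter.1 (hRS hr)
  have hσr : σ • r ∈ fccSlots := by
    rcases hσ with rfl | rfl
    · rw [one_smul]; exact hrS
    · rw [neg_one_smul]; exact neg_mem_fccSlots hrS
  -- the signature slot `w` with `sigFrame ε w = σ F r`
  set w : EuclideanSpace ℝ (Fin 3) := sigFrame ε (σ • F r) with hw
  have hwS : w ∈ fccSlots := hpull _ ⟨σ • r, mem_coe.2 hσr, by rw [LinearIsometryEquiv.map_smul]⟩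
  have hwn : ⟪w, n⟫_ℝ = 0 := by
    rw [hw, hn, ← hadj, hinv, real_inner_smul_left, LinearIsometryEquiv.inner_map_map, inner_single_two_one, hr2, mul_zero]
  have hwplane : w ∈ planeHexagon n := mem_filter.2 ⟨hwS, hwn⟩
  have hdirw : sigFrame ε w = σ • F r := by rw [hw, hinv]
  rcases hcol S hS r hr κ hκ (by rw [← hG]; exact hstd) with ⟨hI, hdir⟩ | ⟨hII, hdir, hcross⟩
  · -- type I: signature `(ε, w)`
    have himg : (G : EuclideanSpace ℝ (Fin 3) → EuclideanSpace ℝ (Fin 3)) '' ↑fccSlots =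
        (sigFrame ε : EuclideanSpace ℝ (Fin 3) → EuclideanSpace ℝ (Fin 3)) '' ↑fccSlots := by rw [hG, hI, hF]
    have hdd : sigDir (ε, w) = d := by rw [sigDir, hdirw, ← hdir, ← hd]
    refine ⟨hq, hbY, hpay, (ε, w), mem_union_left _ (mem_image.2 ⟨w, hwplane, rfl⟩), by rw [hdd]; exact hqd, ?_⟩
    rw [hdd]
    exact (isEndMove_congr himg v d q b).1 hmove
  · -- type II: signature `(¬ε, −w)`
    have himg : (G : EuclideanSpace ℝ (Fin 3) → EuclideanSpace ℝ (Fin 3)) '' ↑fccSlots =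
        (sigFrame (!ε) : EuclideanSpace ℝ (Fin 3) → EuclideanSpace ℝ (Fin 3)) '' ↑fccSlots := by
      rw [hG, hII, hF, image_sigFrame_not]
    have hw2 : (-w) 2 ≠ 0 := by
      intro h0
      have h0' : w 2 = 0 := by
        have : (-w) 2 = -(w 2) := rfl
        rw [this] at h0; linarith
      rw [hw, sigFrame_apply_two_eq_zero_iff] at h0'
      have : (σ • F r) 2 = σ * (F r) 2 := rfl
      rw [this] at h0'
      rcases hσ with rfl | rfl
      · exact hcross (by linarith)
      · exact hcross (by linarith)
    have hdd : sigDir (!ε, -w) = d := by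
      rw [sigDir]
      change sigFrame (!ε) (-w) = d
      rw [map_neg, sigFrame_not_apply, hdirw, ← hdir, ← hd]
    refine ⟨hq, hbY, hpay, (!ε, -w), mem_union_right _ (mem_image.2 ⟨-w, mem_filter.2 ⟨mem_filter.2
      ⟨neg_mem_fccSlots hwS, by rw [inner_neg_left, hwn, neg_zero]⟩, hw2⟩, rfl⟩), by rw [hdd]; exact hqd, ?_⟩
    rw [hdd]
    exact (isEndMove_congr himg v d q b).1 hmove

/-- **DOMINATION FOR ROOT-ONLY TWIN SYSTEMS.**  See the module docstring. -/
theorem dominate_twin_of_roots (L' : EuclideanSpace ℝ (Fin 3) ≃ₗᵢ[ℝ] EuclideanSpace ℝ (Fin 3))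
    (R : Finset (EuclideanSpace ℝ (Fin 3))) (hR : R ⊆ basalHexagon) (u : EuclideanSpace ℝ (Fin 3))
    (hRu : ∀ r ∈ R, 0 < ⟪r, u⟫_ℝ) (ε : Bool)
    (hL : (L' : EuclideanSpace ℝ (Fin 3) → EuclideanSpace ℝ (Fin 3)) '' ↑fccSlots =
      (sigFrame ε : EuclideanSpace ℝ (Fin 3) → EuclideanSpace ℝ (Fin 3)) '' ↑fccSlots)
    (hax : L' (EuclideanSpace.single (2 : Fin 3) (1 : ℝ)) = EuclideanSpace.single (2 : Fin 3) (1 : ℝ) ∨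
      L' (EuclideanSpace.single (2 : Fin 3) (1 : ℝ)) = -EuclideanSpace.single (2 : Fin 3) (1 : ℝ))
    (hroot₁ : ∀ r ∈ R, ∀ κ : List (EuclideanSpace ℝ (Fin 3)), WFChain r κ →
      (((⟨L', R⟩ : PlateSystem).Fw κ : EuclideanSpace ℝ (Fin 3) → EuclideanSpace ℝ (Fin 3)) '' ↑fccSlots = ↑fccSlots ∨
        ((⟨L', R⟩ : PlateSystem).Fw κ : EuclideanSpace ℝ (Fin 3) → EuclideanSpace ℝ (Fin 3)) '' ↑fccSlots =
          (basalMirror : EuclideanSpace ℝ (Fin 3) → EuclideanSpace ℝ (Fin 3)) '' ↑fccSlots) → κ = [])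
    (hroot₂ : ∀ r ∈ R, ∀ κ : List (EuclideanSpace ℝ (Fin 3)), WFChain r κ →
      (((⟨((ℝ ∙ EuclideanSpace.single (2 : Fin 3) (1 : ℝ)).reflection).trans L', R⟩ : PlateSystem).Fw κ :
          EuclideanSpace ℝ (Fin 3) → EuclideanSpace ℝ (Fin 3)) '' ↑fccSlots = ↑fccSlots ∨
        ((⟨((ℝ ∙ EuclideanSpace.single (2 : Fin 3) (1 : ℝ)).reflection).trans L', R⟩ : PlateSystem).Fw κ :
          EuclideanSpace ℝ (Fin 3) → EuclideanSpace ℝ (Fin 3)) '' ↑fccSlots =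
          (basalMirror : EuclideanSpace ℝ (Fin 3) → EuclideanSpace ℝ (Fin 3)) '' ↑fccSlots) → κ = []) :
    ∃ h ∈ basalHexagon, ∀ b q : EuclideanSpace ℝ (Fin 3), dist (0 : EuclideanSpace ℝ (Fin 3)) b ≤ 1 →
      IsEndPairA Y v ⟨L', R⟩ ⟨((ℝ ∙ EuclideanSpace.single (2 : Fin 3) (1 : ℝ)).reflection).trans L', R⟩ b q →
      IsEndPairSig Y v (twinSigs ε h) b q := by
  classical
  set e₃ : EuclideanSpace ℝ (Fin 3) := EuclideanSpace.single (2 : Fin 3) (1 : ℝ) with he₃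
  obtain ⟨h, hh, hsec⟩ := exists_sector_of_halfplane (L' u)
  refine ⟨h, hh, ?_⟩
  have hRs : R ⊆ fccSlots := fun r hr => (mem_filter.1 (hR hr)).1
  -- root images are basal slots in the sector
  have hroot_img : ∀ r ∈ R, L' r ∈ fccSlots ∧ (L' r) 2 = 0 ∧ L' r ∈ basalSector h := by
    intro r hr
    obtain ⟨hrS, hr2⟩ := mem_filter.1 (hR hr)
    have key : ⟪L' r, L' e₃⟫_ℝ = 0 := by rw [LinearIsometryEquiv.inner_map_map, he₃, inner_single_two_one, hr2]
    have h2 : (L' r) 2 = 0 := by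
      rw [← inner_single_two_one, ← he₃]
      rcases hax with hax | hax
      · rwa [hax] at key
      · rw [hax, inner_neg_right] at key; linarith
    have hmem : L' r ∈ (L' : EuclideanSpace ℝ (Fin 3) → EuclideanSpace ℝ (Fin 3)) '' ↑fccSlots := ⟨r, mem_coe.2 hrS, rfl⟩
    rw [hL] at hmem
    obtain ⟨w₀, hw₀, heq⟩ := hmem
    have hw₀2 : w₀ 2 = 0 := by rw [← sigFrame_apply_two_eq_zero_iff ε, heq, h2]
    have hLr : L' r = w₀ := by rw [← heq, sigFrame_of_basal ε hw₀2]
    have hslot : L' r ∈ fccSlots := by rw [hLr]; exact mem_coe.1 hw₀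
    refine ⟨hslot, h2, mem_filter.2 ⟨mem_filter.2 ⟨hslot, h2⟩, hsec _ (mem_filter.2 ⟨hslot, h2⟩) ?_⟩⟩
    rw [LinearIsometryEquiv.inner_map_map]; exact hRu r hr
  -- the companion's slot dozen
  have hsymm : L'.symm e₃ = e₃ ∨ L'.symm e₃ = -e₃ := by
    rcases hax with hax | hax
    · left
      have := congrArg L'.symm hax
      rw [LinearIsometryEquiv.symm_apply_apply] at this
      exact this.symm
    · right
      have := congrArg L'.symm hax
      rw [LinearIsometryEquiv.symm_apply_apply, map_neg] at this
      rw [← neg_eq_iff_eq_neg]; exact this.symm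
  have hcomm : ∀ x, basalMirror (L' x) = L' (basalMirror x) := by
    intro x
    rw [basalMirror_map, basalMirror_apply_eq]
    rcases hsymm with hsy | hsy
    · rw [hsy]
    · rw [hsy, inner_neg_right, smul_neg, mul_neg, neg_smul, neg_neg]
  have himg₂ : ((((ℝ ∙ e₃).reflection).trans L' : EuclideanSpace ℝ (Fin 3) ≃ₗᵢ[ℝ] EuclideanSpace ℝ (Fin 3)) :
        EuclideanSpace ℝ (Fin 3) → EuclideanSpace ℝ (Fin 3)) '' ↑fccSlots =
      (sigFrame (!ε) : EuclideanSpace ℝ (Fin 3) → EuclideanSpace ℝ (Fin 3)) '' ↑fccSlots := by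
    rw [← image_fccSlots_basalMirror_eq_halfTurn, image_sigFrame_not, ← hL, Set.image_image]
    refine Set.image_congr fun x _ => ?_
    rw [LinearIsometryEquiv.trans_apply]
    change L' (basalMirror x) = _
    exact (hcomm x).symm
  intro b q hb hpair
  obtain ⟨hq, hbY, hpay, G, d, hadm, hqd, hmove⟩ := hpair
  have hstd := std_of_isEndPairA hs hY (S₁ := ⟨L', R⟩) (S₂ := ⟨((ℝ ∙ e₃).reflection).trans L', R⟩) hRs hRs hb
    ⟨hq, hbY, hpay, G, d, hadm, hqd, hmove⟩ hmove
  rcases hadm with ⟨r, hr, κ, hκ, hG, hd⟩ | ⟨r, hr, κ, hκ, hG, hd⟩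
  · -- bottom root class: signature `(ε, L' r)`
    have hκ0 : κ = [] := hroot₁ r hr κ hκ (by rw [← hG]; exact hstd)
    subst hκ0
    obtain ⟨hslot, h2, hsecm⟩ := hroot_img r hr
    have hGL : G = L' := hG
    have hdd : d = L' r := by rw [hd]; simp [PlateSystem.Fw]
    have hsd : sigDir (ε, L' r) = d := by rw [sigDir, hdd]; exact sigFrame_of_basal ε h2
    have himg : (G : EuclideanSpace ℝ (Fin 3) → EuclideanSpace ℝ (Fin 3)) '' ↑fccSlots =
        (sigFrame ε : EuclideanSpace ℝ (Fin 3) → EuclideanSpace ℝ (Fin 3)) '' ↑fccSlots := by rw [hGL, hL]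
    refine ⟨hq, hbY, hpay, (ε, L' r), mem_union_left _ (mem_image.2 ⟨L' r, hsecm, rfl⟩), by rw [hsd]; exact hqd, ?_⟩
    rw [hsd]
    exact (isEndMove_congr himg v d q b).1 hmove
  · -- top root class: signature `(¬ε, −L' r)`
    have hκ0 : κ = [] := hroot₂ r hr κ hκ (by rw [← hG]; exact hstd)
    subst hκ0
    obtain ⟨hslot, h2, hsecm⟩ := hroot_img r hr
    obtain ⟨-, hr2⟩ := mem_filter.1 (hR hr)
    have hdd : d = -L' r := by
      rw [hd]; simp only [PlateSystem.Fw, List.length_nil, pow_zero, one_smul, LinearIsometryEquiv.trans_apply]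
      rw [halfTurn_of_basal hr2, map_neg]
    have h2' : (-L' r) 2 = 0 := by
      have : (-L' r) 2 = -((L' r) 2) := rfl
      rw [this, h2, neg_zero]
    have hsd : sigDir (!ε, -L' r) = d := by rw [sigDir, hdd]; exact sigFrame_of_basal (!ε) h2'
    have himg : (G : EuclideanSpace ℝ (Fin 3) → EuclideanSpace ℝ (Fin 3)) '' ↑fccSlots =
        (sigFrame (!ε) : EuclideanSpace ℝ (Fin 3) → EuclideanSpace ℝ (Fin 3)) '' ↑fccSlots := by rw [hG]; exact himg₂
    refine ⟨hq, hbY, hpay, (!ε, -L' r), mem_union_right _ (mem_image.2 ⟨L' r, hsecm, rfl⟩), by rw [hsd]; exact hqd, ?_⟩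
    rw [hsd]
    exact (isEndMove_congr himg v d q b).1 hmove

/-- **DOMINATION, TRANSLATION SYSTEMS** (any base frame `L′`, basal roots): some `transSigs ε n` dominates. -/
theorem dominate_trans (L' : EuclideanSpace ℝ (Fin 3) ≃ₗᵢ[ℝ] EuclideanSpace ℝ (Fin 3)) (R₁ R₂ : Finset (EuclideanSpace ℝ (Fin 3)))
    (hR₁ : R₁ ⊆ basalHexagon) (hR₂ : R₂ ⊆ basalHexagon) :
    ∃ ε : Bool, ∃ n ∈ modelNormals, ∀ b q : EuclideanSpace ℝ (Fin 3), dist (0 : EuclideanSpace ℝ (Fin 3)) b ≤ 1 →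
      IsEndPairA Y v ⟨L', R₁⟩ ⟨L', R₂⟩ b q → IsEndPairSig Y v (transSigs ε n) b q := by
  classical
  obtain ⟨F, σ, hσ, hFstd, hcol⟩ := class_collapse ⟨L', R₁ ∪ R₂⟩
  obtain ⟨ε, hF⟩ := exists_sigFrame_of_std hFstd
  have h₁ : ∀ κ, (⟨L', R₁⟩ : PlateSystem).Fw κ = (⟨L', R₁ ∪ R₂⟩ : PlateSystem).Fw κ := PlateSystem.fw_eq_of_G₀ rfl
  have h₂ : ∀ κ, (⟨L', R₂⟩ : PlateSystem).Fw κ = (⟨L', R₁ ∪ R₂⟩ : PlateSystem).Fw κ := PlateSystem.fw_eq_of_G₀ rfl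
  obtain ⟨n, hn, hdom⟩ := dominate_of_collapse hs hY ⟨L', R₁⟩ ⟨L', R₂⟩ hR₁ hR₂ ε F σ hσ hF (by
    rintro S (rfl | rfl) r hr κ hκ hstd
    · rw [h₁] at hstd ⊢
      exact hcol r (mem_union_left _ hr) κ hκ hstd
    · rw [h₂] at hstd ⊢
      exact hcol r (mem_union_right _ hr) κ hκ hstd)
  exact ⟨ε, n, hn, hdom⟩

/-- **DOMINATION, TWIN SYSTEMS** (any base frame `L′`, basal roots in an open half-plane): some `transSigs ε n` or some
`twinSigs ε h` dominates. -/
theorem dominate_twin (L' : EuclideanSpace ℝ (Fin 3) ≃ₗᵢ[ℝ] EuclideanSpace ℝ (Fin 3)) (R : Finset (EuclideanSpace ℝ (Fin 3)))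
    (hR : R ⊆ basalHexagon) (u : EuclideanSpace ℝ (Fin 3)) (hRu : ∀ r ∈ R, 0 < ⟪r, u⟫_ℝ) :
    (∃ ε : Bool, ∃ n ∈ modelNormals, ∀ b q : EuclideanSpace ℝ (Fin 3), dist (0 : EuclideanSpace ℝ (Fin 3)) b ≤ 1 →
      IsEndPairA Y v ⟨L', R⟩ ⟨((ℝ ∙ EuclideanSpace.single (2 : Fin 3) (1 : ℝ)).reflection).trans L', R⟩ b q →
      IsEndPairSig Y v (transSigs ε n) b q) ∨
    (∃ ε : Bool, ∃ h ∈ basalHexagon, ∀ b q : EuclideanSpace ℝ (Fin 3), dist (0 : EuclideanSpace ℝ (Fin 3)) b ≤ 1 →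
      IsEndPairA Y v ⟨L', R⟩ ⟨((ℝ ∙ EuclideanSpace.single (2 : Fin 3) (1 : ℝ)).reflection).trans L', R⟩ b q →
      IsEndPairSig Y v (twinSigs ε h) b q) := by
  classical
  set S₁ : PlateSystem := ⟨L', R⟩ with hS₁
  set S₂ : PlateSystem := ⟨((ℝ ∙ EuclideanSpace.single (2 : Fin 3) (1 : ℝ)).reflection).trans L', R⟩ with hS₂
  have hR2 : ∀ r ∈ R, r 2 = 0 := fun r hr => (mem_filter.1 (hR hr)).2
  by_cases h₁ : ∃ r ∈ R, ∃ κ : List (EuclideanSpace ℝ (Fin 3)), WFChain r κ ∧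
      ((S₁.Fw κ : EuclideanSpace ℝ (Fin 3) → EuclideanSpace ℝ (Fin 3)) '' ↑fccSlots = ↑fccSlots ∨
        (S₁.Fw κ : EuclideanSpace ℝ (Fin 3) → EuclideanSpace ℝ (Fin 3)) '' ↑fccSlots =
          (basalMirror : EuclideanSpace ℝ (Fin 3) → EuclideanSpace ℝ (Fin 3)) '' ↑fccSlots)
  · by_cases h₂ : ∃ r ∈ R, ∃ κ : List (EuclideanSpace ℝ (Fin 3)), WFChain r κ ∧
        ((S₂.Fw κ : EuclideanSpace ℝ (Fin 3) → EuclideanSpace ℝ (Fin 3)) '' ↑fccSlots = ↑fccSlots ∨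
          (S₂.Fw κ : EuclideanSpace ℝ (Fin 3) → EuclideanSpace ℝ (Fin 3)) '' ↑fccSlots =
            (basalMirror : EuclideanSpace ℝ (Fin 3) → EuclideanSpace ℝ (Fin 3)) '' ↑fccSlots)
    · -- both plates active: root classes only, standard basal-axis base frame, a twin row dominates
      right
      obtain ⟨r₁, hr₁, κ₁, hκ₁, hstd₁⟩ := h₁
      obtain ⟨r₂, hr₂, κ₂, hκ₂, hstd₂⟩ := h₂
      obtain ⟨hκ₁0, -, hLstd, hax⟩ := twin_collapse L' R R (hR2 r₁ hr₁) hκ₁ hstd₁ (hR2 r₂ hr₂) hκ₂ hstd₂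
      obtain ⟨ε, hL⟩ := exists_sigFrame_of_std hLstd
      obtain ⟨h, hh, hdom⟩ := dominate_twin_of_roots hs hY L' R hR u hRu ε hL hax
        (fun r hr κ hκ hstd => (twin_collapse L' R R (hR2 r hr) hκ hstd (hR2 r₂ hr₂) hκ₂ hstd₂).1)
        (fun r hr κ hκ hstd => (twin_collapse L' R R (hR2 r₁ hr₁) hκ₁ hstd₁ (hR2 r hr) hκ hstd).2.1)
      exact ⟨ε, h, hh, hdom⟩
    · -- only the bottom plate is active
      left
      obtain ⟨F, σ, hσ, hFstd, hcol⟩ := class_collapse S₁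
      obtain ⟨ε, hF⟩ := exists_sigFrame_of_std hFstd
      obtain ⟨n, hn, hdom⟩ := dominate_of_collapse hs hY S₁ S₂ hR hR ε F σ hσ hF (by
        rintro S (rfl | rfl) r hr κ hκ hstd
        · exact hcol r hr κ hκ hstd
        · exact absurd ⟨r, hr, κ, hκ, hstd⟩ h₂)
      exact ⟨ε, n, hn, hdom⟩
  · -- the bottom plate is not active: collapse the top one
    left
    obtain ⟨F, σ, hσ, hFstd, hcol⟩ := class_collapse S₂
    obtain ⟨ε, hF⟩ := exists_sigFrame_of_std hFstd
    obtain ⟨n, hn, hdom⟩ := dominate_of_collapse hs hY S₁ S₂ hR hR ε F σ hσ hF (by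
      rintro S (rfl | rfl) r hr κ hκ hstd
      · exact absurd ⟨r, hr, κ, hκ, hstd⟩ h₁
      · exact hcol r hr κ hκ hstd)
    exact ⟨ε, n, hn, hdom⟩

end Dominate

end Summit.Ventures.Crystal3D.Theorems

end
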